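import Literature.Analysis.FluidPDE.LerayHopfUniformEnergy
import Literature.Analysis.FluidPDE.TimeAverageMeasureBasic
import Literature.Analysis.FunctionSpaces.TorusTrigPoly
import HarnessLib

/-!
# Time-average measures have finite mean enstrophy

Analysis/FluidPDE support file for the discharge of
`Literature.Analysis.FluidPDE.timeAverage_isStationary` (Foias–Manley–Rosa–Temam 2001, Ch. IV
Thm. 3.1): property **(1.29)** of a stationary statistical solution, `∫ ‖u‖² dμ(u) < ∞`, for a
time-average measure `μ` of a global Leray–Hopf solution `u` on `T^d` with steady force `F ∈ L²`
(FMRT 2001, Ch. IV §3.1, proof of (1.29), PDF p. 210, with (3.3)–(3.4)).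

The printed argument: `∫ ‖P_m u‖² dμ = Lim T⁻¹ ∫₀ᵀ ‖P_m u(t)‖² dt ≤ limsup ≤ |u₀|²/(νT) +
|f|²/(ν²λ₁)` by positivity of `Lim` and the a priori estimate (3.4), then `m → ∞` by monotone
convergence. Here `‖P_m u‖²` is the spectral truncation `4π² ∑_{|k| ≤ m} |k|² ‖û(k)‖²`
(`galerkinEnstrophy m`, a continuous function on `H`), further capped at height `M` to obtain a
**bounded** norm-continuous observable (the tree's time-average measures are tested on bounded
observables only); `M → ∞` is a second monotone limit and `m → ∞` is done by Fatou's lemma along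
`‖P_m u‖² → ‖u‖²` (`Torus.eGradNormSq_eq_tsum`).

* `galerkinEnstrophy`, `continuous_galerkinEnstrophy`, `ofReal_galerkinEnstrophy_le_eGradNormSq`,
  `tendsto_ofReal_galerkinEnstrophy`;
* `IsTimeAverageMeasure.integral_le_of_ae_timeMean_le` — the a.e.-in-time variant of
  `IsTimeAverageMeasure.integral_le_of_forall_timeMean_le` (`TimeAverageMeasureBasic`);
* `IsGlobalLerayHopf.ae_eGradNormSq_lt_top`, `IsGlobalLerayHopf.timeMean_enstrophy_le` — the
  slice enstrophy is a.e. finite and its time means are eventually bounded by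
  `B = (|u₀|² + |F|²/ν)/ν` ((3.4) with `λ₁ = 1`, `IsGlobalLerayHopf.toReal_lintegral_eGradNormSq_le`);
* `IsTimeAverageMeasure.lintegral_eGradNormSq_le`, `…lintegral_eGradNormSq_lt_top` — **(1.29)**.

## Mathlib / tree search

Used from Mathlib: `lintegral_iSup` (monotone convergence), `lintegral_liminf_le'` (Fatou),
`ofReal_integral_eq_lintegral_ofReal`, `integral_toReal`; from the tree
`Torus.continuous_mFourierCoeff_complexify_coe`, `Torus.eGradNormSq_eq_tsum`,
`Torus.tendsto_freqBall_atTop`, `LerayHopfUniformEnergy`, `TimeAverageMeasureBasic`.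

## References

* C. Foias, O. Manley, R. Rosa, R. Temam, *Navier–Stokes Equations and Turbulence*, Cambridge
  Univ. Press (2001), Ch. IV §1.2 Def. 1.3 (1.29) (PDF p. 197); §3.1 (3.3)–(3.4) and the proof of
  (1.29) (PDF p. 210). [FMRT2001]
-/

noncomputable section

open MeasureTheory Set Filter Topology UnitAddTorus
open scoped InnerProductSpace RealInnerProductSpace ENNReal NNReal

namespace Literature.Analysis.FluidPDE.Torus

variable {d : Type*} [Fintype d] [DecidableEq d]

/-- Local notation for the real Hilbert space `L²(T^d; ℝ^d)`. -/
local notation "L2T " d':max => Lp (EuclideanSpace ℝ d') 2 (volume : Measure (UnitAddTorus d'))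

/-- Local notation for real vector fields `T^d → ℝ^d`. -/
local notation "Vec " d':max => UnitAddTorus d' → EuclideanSpace ℝ d'

/-! ### The truncated spectral enstrophy as a continuous function on `H` -/

section Trunc

/-- The **truncated spectral enstrophy** of order `m` on `H`:
`‖P_m u‖² = 4π² ∑_{|k| ≤ m} |k|² ‖û(k)‖²` (FMRT 2001, Ch. IV §3.1, `Φ(u) = ‖P_m u‖²`, p. 210;
spectral form of `Torus.eGradNormSq ∘ fourierTruncate m`, cf.
`Torus.eGradNormSq_fourierTruncate_eq_sum`). A real-valued finite sum of continuous functions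
of `u`. [cite: FMRT2001, Ch. IV §3.1 (3.3)] -/
def galerkinEnstrophy (m : ℕ) (v : FunctionSpaces.Torus.energySpace d) : ℝ :=
  4 * Real.pi ^ 2 * ∑ k ∈ FunctionSpaces.Torus.freqBall m, FunctionSpaces.Torus.freqNormSq k *
    ‖mFourierCoeff (FunctionSpaces.EuclideanSpace.complexify ∘ ((v : L2T d) : Vec d)) k‖ ^ 2

/-- The truncated enstrophy is nonnegative. [folklore] -/
theorem galerkinEnstrophy_nonneg (m : ℕ) (v : FunctionSpaces.Torus.energySpace d) : 0 ≤ galerkinEnstrophy m v :=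
  mul_nonneg (by positivity) (Finset.sum_nonneg fun k _ =>
    mul_nonneg (FunctionSpaces.Torus.freqNormSq_nonneg k) (sq_nonneg _))

/-- The truncated enstrophy is norm-continuous on `H` (each Fourier coefficient is continuous on
`L²`, `Torus.continuous_mFourierCoeff_complexify_coe`). [folklore] -/
theorem continuous_galerkinEnstrophy (m : ℕ) :
    Continuous (galerkinEnstrophy (d := d) m) := by
  unfold galerkinEnstrophy
  refine continuous_const.mul (continuous_finsetSum _ fun k _ => continuous_const.mul ?_)
  exact (((continuous_mFourierCoeff_complexify_coe k).comp continuous_subtype_val).norm).pow 2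

/-- The truncated enstrophy in `[0, ∞]` is the partial sum of the spectral series of `‖∇·‖₂²`. [folklore] -/
theorem ofReal_galerkinEnstrophy_eq (m : ℕ) (v : FunctionSpaces.Torus.energySpace d) :
    ENNReal.ofReal (galerkinEnstrophy m v) = ENNReal.ofReal (4 * Real.pi ^ 2) *
      ∑ k ∈ FunctionSpaces.Torus.freqBall m, ENNReal.ofReal (FunctionSpaces.Torus.freqNormSq k) *
        ‖mFourierCoeff (FunctionSpaces.EuclideanSpace.complexify ∘ ((v : L2T d) : Vec d)) k‖ₑ ^ 2 := by
  unfold galerkinEnstrophy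
  rw [ENNReal.ofReal_mul (by positivity), ENNReal.ofReal_sum_of_nonneg fun k _ =>
    mul_nonneg (FunctionSpaces.Torus.freqNormSq_nonneg k) (sq_nonneg _)]
  congr 1
  refine Finset.sum_congr rfl fun k _ => ?_
  rw [ENNReal.ofReal_mul (FunctionSpaces.Torus.freqNormSq_nonneg k), ← ofReal_norm,
    ENNReal.ofReal_pow (norm_nonneg _)]

/-- `‖P_m u‖² ≤ ‖u‖²` in `[0, ∞]`: the partial sum is dominated by the series
(`Torus.eGradNormSq_eq_tsum`). [folklore] -/
theorem ofReal_galerkinEnstrophy_le_eGradNormSq (m : ℕ) (v : FunctionSpaces.Torus.energySpace d) :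
    ENNReal.ofReal (galerkinEnstrophy m v) ≤ FunctionSpaces.Torus.eGradNormSq ((v : L2T d) : Vec d) := by
  rw [ofReal_galerkinEnstrophy_eq, FunctionSpaces.Torus.eGradNormSq_eq_tsum]
  gcongr
  exact ENNReal.sum_le_tsum _

/-- `‖P_m u‖² → ‖u‖²` in `[0, ∞]` as `m → ∞` (the frequency balls exhaust `ℤ^d`,
`Torus.tendsto_freqBall_atTop`). [folklore] -/
theorem tendsto_ofReal_galerkinEnstrophy (v : FunctionSpaces.Torus.energySpace d) :
    Tendsto (fun m => ENNReal.ofReal (galerkinEnstrophy m v)) atTop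
      (𝓝 (FunctionSpaces.Torus.eGradNormSq ((v : L2T d) : Vec d))) := by
  have hsum : HasSum (fun k : d → ℤ => ENNReal.ofReal (FunctionSpaces.Torus.freqNormSq k) *
      ‖mFourierCoeff (FunctionSpaces.EuclideanSpace.complexify ∘ ((v : L2T d) : Vec d)) k‖ₑ ^ 2)
      (∑' k : d → ℤ, ENNReal.ofReal (FunctionSpaces.Torus.freqNormSq k) *
        ‖mFourierCoeff (FunctionSpaces.EuclideanSpace.complexify ∘ ((v : L2T d) : Vec d)) k‖ₑ ^ 2) :=
    ENNReal.summable.hasSum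
  have h := ENNReal.Tendsto.const_mul (a := ENNReal.ofReal (4 * Real.pi ^ 2))
    (hsum.comp FunctionSpaces.Torus.tendsto_freqBall_atTop) (Or.inr ENNReal.ofReal_ne_top)
  rw [← FunctionSpaces.Torus.eGradNormSq_eq_tsum] at h
  refine h.congr fun m => ?_
  rw [Function.comp_apply, ofReal_galerkinEnstrophy_eq]

end Trunc

/-! ### Upper bounds through time means of an a.e. majorant -/

section Majorant

variable {Λ : GeneralizedLimit} {U : ℝ → FunctionSpaces.Torus.energySpace d}
  {μ : Measure (FunctionSpaces.Torus.energySpace d)}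

/-- **Upper bounds through time means of an a.e. majorant** (positivity of `Lim`; FMRT 2001,
Ch. IV §3.1, proof of (1.29), p. 210): as `IsTimeAverageMeasure.integral_le_of_forall_timeMean_le`,
but the majorisation `Ψ(U t) ≤ k t` is only required for a.e. `t > 0`. [cite: FMRT2001, Ch. IV §3.1 (3.3)–(3.4)] -/
theorem IsTimeAverageMeasure.integral_le_of_ae_timeMean_le
    (hμ : IsTimeAverageMeasure Λ.longTimeAvg U μ)
    {Ψ : FunctionSpaces.Torus.energySpace d → ℝ} (hΨ : Continuous Ψ) (h0 : ∀ u, 0 ≤ Ψ u) {C : ℝ}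
    (hC : ∀ u, Ψ u ≤ C) {k : ℝ → ℝ} (hk : ∀ᵐ t ∂volume, 0 < t → Ψ (U t) ≤ k t)
    (hki : ∀ T, 0 < T → IntegrableOn k (Ioc 0 T)) {B : ℝ} (hB : ∀ᶠ T in atTop, timeMean k T ≤ B) :
    ∫ v, Ψ v ∂μ ≤ B := by
  have habs : ∀ u, |Ψ u| ≤ C := fun u => by rw [abs_of_nonneg (h0 u)]; exact hC u
  rw [hμ.integral_eq hΨ habs]
  refine Λ.apply_le_of_eventually_le (isBoundedUnder_ge_timeMean fun t _ => habs _) ?_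
  filter_upwards [hB, eventually_gt_atTop 0] with T hTB hT
  refine le_trans ?_ hTB
  unfold timeMean
  rw [intervalIntegral.integral_of_le hT.le, intervalIntegral.integral_of_le hT.le]
  refine mul_le_mul_of_nonneg_left ?_ (inv_nonneg.2 hT.le)
  refine integral_mono_of_nonneg (ae_of_all _ fun t => h0 _) (hki T hT) ?_
  filter_upwards [ae_restrict_mem measurableSet_Ioc, ae_restrict_of_ae hk] with t ht hkt
  exact hkt ht.1

end Majorant

/-! ### The slice enstrophy of a Leray–Hopf solution: a.e. finiteness and bounded time means -/

section Slice

variable {ν : ℝ} {F u₀ : Vec d} {u : ℝ → Vec d} {U : ℝ → FunctionSpaces.Torus.energySpace d}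

/-- Along a global Leray–Hopf solution the slice enstrophy `‖∇u(t)‖₂²` is finite for a.e. `t > 0`
(`∫₀ⁿ ‖∇u‖₂² < ∞` for every `n`). [folklore] -/
theorem IsGlobalLerayHopf.ae_eGradNormSq_lt_top (hu : IsGlobalLerayHopf ν (fun _ => F) u₀ u) :
    ∀ᵐ t ∂volume, 0 < t → FunctionSpaces.Torus.eGradNormSq (u t) < ⊤ := by
  have hn : ∀ n : ℕ, ∀ᵐ t ∂volume, t ∈ Ioo (0 : ℝ) (n + 1) → FunctionSpaces.Torus.eGradNormSq (u t) < ⊤ := by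
    intro n
    have hLH := hu ((n : ℝ) + 1) (by positivity)
    exact (ae_restrict_iff' measurableSet_Ioo).1
      (ae_lt_top' hLH.aemeasurable_eGradNormSq hLH.lintegral_eGradNormSq_lt_top.ne)
  rw [← ae_all_iff] at hn
  filter_upwards [hn] with t ht ht0
  obtain ⟨n, hn'⟩ := exists_nat_gt t
  exact ht n ⟨ht0, by linarith⟩

/-- The real slice enstrophy `t ↦ (‖∇u(t)‖₂²).toReal` is integrable on every `(0, T]` and its
integral is the real part of the lower integral. [folklore] -/
theorem IsGlobalLerayHopf.integrableOn_toReal_eGradNormSq (hu : IsGlobalLerayHopf ν (fun _ => F) u₀ u)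
    {T : ℝ} (hT : 0 < T) :
    IntegrableOn (fun t => (FunctionSpaces.Torus.eGradNormSq (u t)).toReal) (Ioc 0 T) ∧
      ∫ t in Ioc 0 T, (FunctionSpaces.Torus.eGradNormSq (u t)).toReal =
        (∫⁻ t in Ioo 0 T, FunctionSpaces.Torus.eGradNormSq (u t)).toReal := by
  have hLH := hu T hT
  have hmeas := hLH.aemeasurable_eGradNormSq
  have hfin := hLH.lintegral_eGradNormSq_lt_top
  refine ⟨(integrableOn_Ioc_iff_integrableOn_Ioo).mpr (integrable_toReal_of_lintegral_ne_top hmeas hfin.ne), ?_⟩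
  rw [setIntegral_congr_set (Ioo_ae_eq_Ioc (μ := volume) (a := (0 : ℝ)) (b := T)).symm,
    integral_toReal hmeas (ae_lt_top' hmeas hfin.ne)]

/-- **Bounded time means of the enstrophy, FMRT (3.4)**: for `T ≥ 1`,
`T⁻¹ ∫₀ᵀ ‖∇u‖₂² ≤ (|u₀|² + |F|²/ν)/ν` (from `IsGlobalLerayHopf.toReal_lintegral_eGradNormSq_le`,
`λ₁ = 1`). [cite: FMRT2001, Ch. IV §3.1 (3.4)] -/
theorem IsGlobalLerayHopf.timeMean_enstrophy_le (hν : 0 < ν) (hF : MemLp F 2 volume)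
    (hu : IsGlobalLerayHopf ν (fun _ => F) u₀ u)
    (hU : ∀ t, 0 ≤ t → ((U t : L2T d) : Vec d) =ᵐ[volume] u t) {T : ℝ} (hT : 1 ≤ T) :
    timeMean (fun t => (FunctionSpaces.Torus.eGradNormSq (u t)).toReal) T ≤
      (2 * FunctionSpaces.Torus.kineticEnergy u₀ + (∫ x, ‖F x‖ ^ 2) / ν) / ν := by
  have hT0 : 0 < T := one_pos.trans_le hT
  set E₀ : ℝ := 2 * FunctionSpaces.Torus.kineticEnergy u₀ with hE₀
  set C : ℝ := (∫ x, ‖F x‖ ^ 2) / ν with hC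
  have hE₀0 : 0 ≤ E₀ := mul_nonneg zero_le_two (FunctionSpaces.Torus.kineticEnergy_nonneg _)
  have hC0 : 0 ≤ C := div_nonneg (integral_nonneg fun x => sq_nonneg _) hν.le
  have hD := hu.toReal_lintegral_eGradNormSq_le hν hF hU hT0.le
  set D : ℝ := (∫⁻ t in Ioo 0 T, FunctionSpaces.Torus.eGradNormSq (u t)).toReal with hDdef
  have hD' : D ≤ (E₀ + C * T) / ν := by
    rw [le_div_iff₀ hν, mul_comm]
    exact hD
  unfold timeMean
  rw [intervalIntegral.integral_of_le hT0.le, (hu.integrableOn_toReal_eGradNormSq hT0).2]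
  calc T⁻¹ * D ≤ T⁻¹ * ((E₀ + C * T) / ν) := mul_le_mul_of_nonneg_left hD' (inv_nonneg.2 hT0.le)
    _ = (E₀ / T + C) / ν := by field_simp
    _ ≤ (E₀ + C) / ν := by
        refine div_le_div_of_nonneg_right ?_ hν.le
        simpa using div_le_self hE₀0 hT

end Slice

/-! ### Finite mean enstrophy of time-average measures -/

section Enstrophy

variable {ν : ℝ} {F u₀ : Vec d} {u : ℝ → Vec d} {U : ℝ → FunctionSpaces.Torus.energySpace d}
  {Λ : GeneralizedLimit} {μ : Measure (FunctionSpaces.Torus.energySpace d)}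

/-- The capped truncated enstrophy `min(‖P_m u‖², M)` has `μ`-mean at most `B = (|u₀|² + |F|²/ν)/ν`
for every time-average measure `μ` (FMRT 2001, Ch. IV §3.1, (3.3)–(3.4): positivity of `Lim`). [cite: FMRT2001, Ch. IV §3.1 (3.3)–(3.4)] -/
theorem IsTimeAverageMeasure.integral_min_galerkinEnstrophy_le (hν : 0 < ν) (hF : MemLp F 2 volume)
    (hu : IsGlobalLerayHopf ν (fun _ => F) u₀ u)
    (hU : ∀ t, 0 ≤ t → ((U t : L2T d) : Vec d) =ᵐ[volume] u t)
    (hμ : IsTimeAverageMeasure Λ.longTimeAvg U μ) (m : ℕ) {M : ℝ} (hM : 0 ≤ M) :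
    ∫ v, min (galerkinEnstrophy m v) M ∂μ ≤
      (2 * FunctionSpaces.Torus.kineticEnergy u₀ + (∫ x, ‖F x‖ ^ 2) / ν) / ν := by
  refine hμ.integral_le_of_ae_timeMean_le ((continuous_galerkinEnstrophy m).min continuous_const)
    (fun v => le_min (galerkinEnstrophy_nonneg m v) hM) (fun v => min_le_right _ _)
    (k := fun t => (FunctionSpaces.Torus.eGradNormSq (u t)).toReal) ?_
    (fun T hT => (hu.integrableOn_toReal_eGradNormSq hT).1)
    ((eventually_ge_atTop 1).mono fun T hT => hu.timeMean_enstrophy_le hν hF hU hT)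
  filter_upwards [hu.ae_eGradNormSq_lt_top] with t ht ht0
  refine (min_le_left _ _).trans ?_
  have hfin := ht ht0
  rw [← eGradNormSq_coe_lift hU ht0.le] at hfin
  have h := ofReal_galerkinEnstrophy_le_eGradNormSq m (U t)
  rw [← eGradNormSq_coe_lift hU ht0.le]
  exact (ENNReal.ofReal_le_iff_le_toReal hfin.ne).1 h

/-- **Finite mean enstrophy of time-average measures, with the bound (1.33)-type constant**
(FMRT 2001, Ch. IV §3.1, proof of (1.29), p. 210): `∫ ‖∇u‖₂² dμ ≤ (|u₀|² + |F|²/ν)/ν` for a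
time-average measure of the lift of a global Leray–Hopf solution with `ν > 0` and steady force
`F ∈ L²` (monotone convergence in the cap `M`, Fatou in the truncation order `m`). [cite: FMRT2001, Ch. IV §3.1, proof of (1.29), p. 210] -/
theorem IsTimeAverageMeasure.lintegral_eGradNormSq_le (hν : 0 < ν) (hF : MemLp F 2 volume)
    (hu : IsGlobalLerayHopf ν (fun _ => F) u₀ u)
    (hU : ∀ t, 0 ≤ t → ((U t : L2T d) : Vec d) =ᵐ[volume] u t)
    (hμ : IsTimeAverageMeasure Λ.longTimeAvg U μ) :
    ∫⁻ v, FunctionSpaces.Torus.eGradNormSq ((v : L2T d) : Vec d) ∂μ ≤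
      ENNReal.ofReal ((2 * FunctionSpaces.Torus.kineticEnergy u₀ + (∫ x, ‖F x‖ ^ 2) / ν) / ν) := by
  haveI := hμ.1
  set B : ℝ := (2 * FunctionSpaces.Torus.kineticEnergy u₀ + (∫ x, ‖F x‖ ^ 2) / ν) / ν with hB
  -- each truncation has lower integral `≤ B` (monotone convergence in the cap)
  have htrunc : ∀ m, ∫⁻ v, ENNReal.ofReal (galerkinEnstrophy m v) ∂μ ≤ ENNReal.ofReal B := by
    intro m
    set f : ℕ → FunctionSpaces.Torus.energySpace d → ℝ≥0∞ := fun M v =>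
      ENNReal.ofReal (min (galerkinEnstrophy m v) M) with hf
    have hf_meas : ∀ M, Measurable (f M) := fun M =>
      ENNReal.measurable_ofReal.comp ((continuous_galerkinEnstrophy m).min continuous_const).measurable
    have hf_mono : Monotone f := fun M M' hMM' v =>
      ENNReal.ofReal_le_ofReal (min_le_min_left _ (by exact_mod_cast hMM'))
    have hsup : ∀ v, (⨆ M, f M v) = ENNReal.ofReal (galerkinEnstrophy m v) := by
      intro v
      refine le_antisymm (iSup_le fun M => ENNReal.ofReal_le_ofReal (min_le_left _ _)) ?_
      refine le_iSup_of_le ⌈galerkinEnstrophy m v⌉₊ (le_of_eq ?_)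
      simp only [hf]
      rw [min_eq_left (Nat.le_ceil _)]
    calc ∫⁻ v, ENNReal.ofReal (galerkinEnstrophy m v) ∂μ = ∫⁻ v, ⨆ M, f M v ∂μ :=
          lintegral_congr fun v => (hsup v).symm
      _ = ⨆ M, ∫⁻ v, f M v ∂μ := lintegral_iSup hf_meas hf_mono
      _ ≤ ENNReal.ofReal B := iSup_le fun M => by
          have hint : Integrable (fun v => min (galerkinEnstrophy m v) (M : ℝ)) μ :=
            Integrable.of_bound ((continuous_galerkinEnstrophy m).min continuous_const).aestronglyMeasurable M
              (ae_of_all _ fun v => by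
                rw [Real.norm_eq_abs, abs_of_nonneg (le_min (galerkinEnstrophy_nonneg m v) (Nat.cast_nonneg M))]
                exact min_le_right _ _)
          simp only [hf]
          rw [← ofReal_integral_eq_lintegral_ofReal hint
            (ae_of_all _ fun v => le_min (galerkinEnstrophy_nonneg m v) (Nat.cast_nonneg M))]
          exact ENNReal.ofReal_le_ofReal
            (hμ.integral_min_galerkinEnstrophy_le hν hF hu hU m (Nat.cast_nonneg M))
  -- Fatou along `‖P_m u‖² → ‖u‖²`
  have hmeas : ∀ m, AEMeasurable (fun v => ENNReal.ofReal (galerkinEnstrophy m v)) μ := fun m =>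
    (ENNReal.measurable_ofReal.comp (continuous_galerkinEnstrophy m).measurable).aemeasurable
  calc ∫⁻ v, FunctionSpaces.Torus.eGradNormSq ((v : L2T d) : Vec d) ∂μ
      = ∫⁻ v, liminf (fun m => ENNReal.ofReal (galerkinEnstrophy m v)) atTop ∂μ :=
        lintegral_congr fun v => ((tendsto_ofReal_galerkinEnstrophy v).liminf_eq).symm
    _ ≤ liminf (fun m => ∫⁻ v, ENNReal.ofReal (galerkinEnstrophy m v) ∂μ) atTop := lintegral_liminf_le' hmeas
    _ ≤ ENNReal.ofReal B := liminf_le_of_le (by isBoundedDefault) fun b hb =>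
        (hb.and (Eventually.of_forall htrunc)).exists.elim fun m hm => hm.1.trans hm.2

/-- **Time-average measures have finite mean enstrophy, FMRT (1.29)**: `∫ ‖∇u‖₂² dμ(u) < ∞` —
the first defining property of a stationary statistical solution, for time-average measures of
global Leray–Hopf solutions on `T^d` with `ν > 0` and steady `L²` force (FMRT 2001, Ch. IV
Thm. 3.1, part (1.29), §3.1 p. 210). [cite: FMRT2001, Ch. IV §3.1 Thm. 3.1, proof of (1.29), p. 210] -/
theorem IsTimeAverageMeasure.lintegral_eGradNormSq_lt_top (hν : 0 < ν) (hF : MemLp F 2 volume)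
    (hu : IsGlobalLerayHopf ν (fun _ => F) u₀ u)
    (hU : ∀ t, 0 ≤ t → ((U t : L2T d) : Vec d) =ᵐ[volume] u t)
    (hμ : IsTimeAverageMeasure Λ.longTimeAvg U μ) :
    ∫⁻ v, FunctionSpaces.Torus.eGradNormSq ((v : L2T d) : Vec d) ∂μ < ⊤ :=
  (hμ.lintegral_eGradNormSq_le hν hF hu hU).trans_lt ENNReal.ofReal_lt_top

end Enstrophy

end Literature.Analysis.FluidPDE.Torus
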